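import Literature.NumberTheory.CubicFields.DavenportBoundNeg
import Literature.NumberTheory.CubicFields.ThreeTorsionMeanBound
import HarnessLib

/-!
# The mean of `#Cl₃` over fundamental discriminants is bounded — from the dictionary alone

`Proofs` file (theorems only), topic `Literature/NumberTheory/CubicFields`, the Scholz-free version of
`ThreeTorsionMeanBound.lean`: with Davenport's bound now proved for BOTH signs of the discriminant
(`ncard_gl2zOrbits_pos_le`, `ncard_gl2zOrbits_neg_le`), hypothesis (A) of
`btt_uniformity_sqDvd_of_mean_of_perDisc` — `Σ_{0<±D<Y, D fund.} #Cl₃(D) ≤ C·Y` — follows from Hasse's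
dictionary `#Cl₃(D) = 2·N₃(D) + 1` alone (`mean_threeTorsion_of_dictionary`).

## References

* K. Belabas, M. Bhargava, C. Pomerance, *Error estimates for the Davenport–Heilbronn theorems*,
  Duke Math. J. 153 (2010) 173–210, Lemma 3.3 (proof) [BelabasBhargavaPomerance2010].
* H. Davenport, *On the class-number of binary cubic forms I, II*, J. London Math. Soc. 26 (1951)
  [Davenport1951CubicFormsI] [Davenport1951CubicFormsII].
-/

noncomputable section

namespace Literature.NumberTheory.CubicFields

open NumberField BinaryCubic RingOfForm Finset Literature.NumberTheory.QuadraticFields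

/-- **`Σ_{D ∈ negFundDiscrs Y} #Cl₃(D) ≤ 240001·Y`** from the dictionary (hypothesis) and Davenport's bound
for negative discriminants `ncard_gl2zOrbits_neg_le` (proved): `#Cl₃(D) = 2·N₃(D) + 1`,
`Σ_D N₃(D) ≤ #{orbits of irreducible forms, 0 < −Disc < Y} ≤ 120000·Y`.
[cite: BelabasBhargavaPomerance2010, Lemma 3.3 (proof, first display)] -/
theorem mean_threeTorsion_neg_of_dictionary
    (hdict : ∀ D : ℤ, ((D % 4 = 1 ∧ Squarefree D ∧ D ≠ 1) ∨
      (4 ∣ D ∧ (D / 4 % 4 = 2 ∨ D / 4 % 4 = 3) ∧ Squarefree (D / 4))) →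
      quadFieldThreeTorsion D = 2 * cubicFieldCountOfDisc D + 1) (Y : ℕ) :
    (∑ D ∈ negFundDiscrs Y, (quadFieldThreeTorsion D : ℝ)) ≤ 240001 * Y := by
  classical
  set T : Finset ℤ := negFundDiscrs Y with hTdef
  set Sd : ℤ → Set (Set (BinaryCubic ℤ)) := fun d =>
    {O | ∃ f : BinaryCubic ℤ, O = gl2zOrbit f ∧ f.IsIrreducible ∧ IsMaximal f ∧ f.disc = d} with hSd
  set B : Set (Set (BinaryCubic ℤ)) :=
    {O | ∃ f : BinaryCubic ℤ, O = gl2zOrbit f ∧ f.IsIrreducible ∧ 0 < -f.disc ∧ -f.disc < Y} with hBdef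
  have hT : ∀ D ∈ T, (-(Y : ℤ) < D ∧ D < 0) ∧ ((D % 4 = 1 ∧ Squarefree D ∧ D ≠ 1) ∨
      (4 ∣ D ∧ (D / 4 % 4 = 2 ∨ D / 4 % 4 = 3) ∧ Squarefree (D / 4))) := fun D hD =>
    mem_negFundDiscrs.mp hD
  have hT0 : ∀ D ∈ T, D ≠ 0 := fun D hD => (hT D hD).1.2.ne
  have hBfin : B.Finite := by
    refine (Set.Finite.biUnion (Finset.Ioo (-(Y : ℤ)) 0).finite_toSet fun D hD =>
      orbitsOfDisc_finite (Finset.mem_Ioo.mp hD).2.ne).subset ?_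
    rintro O ⟨f, rfl, -, h0, hY⟩
    exact Set.mem_biUnion (Finset.mem_coe.mpr (Finset.mem_Ioo.mpr ⟨by omega, by omega⟩)) ⟨f, rfl, rfl⟩
  have hsum : ∑ D ∈ T, (cubicFieldCountOfDisc D : ℝ) ≤ 120000 * Y := by
    have h1 : ∑ D ∈ T, cubicFieldCountOfDisc D = (⋃ D ∈ T, Sd D).ncard := by
      rw [ncard_biUnion_eq_sum_of_disjoint T Sd (fun D hD => irredMaximalOrbitsOfDisc_finite (hT0 D hD)) ?_]
      · exact Finset.sum_congr rfl fun D _ => (ncard_irredMaximalOrbitsOfDisc D).symm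
      · intro i _ j _ hij
        refine (disjoint_orbitsOfDisc hij).mono ?_ ?_
        · rintro O ⟨f, hO, -, -, hd⟩
          exact ⟨f, hO, hd⟩
        · rintro O ⟨f, hO, -, -, hd⟩
          exact ⟨f, hO, hd⟩
    have h2 : (⋃ D ∈ T, Sd D) ⊆ B := by
      intro O hO
      obtain ⟨D, hD, hOD⟩ := Set.mem_iUnion₂.mp hO
      obtain ⟨f, rfl, hirr, -, hd⟩ := hOD
      have h := (hT D hD).1
      exact ⟨f, rfl, hirr, by rw [hd]; omega, by rw [hd]; omega⟩
    calc ∑ D ∈ T, (cubicFieldCountOfDisc D : ℝ) = ((∑ D ∈ T, cubicFieldCountOfDisc D : ℕ) : ℝ) := by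
          push_cast; rfl
      _ = (((⋃ D ∈ T, Sd D).ncard : ℕ) : ℝ) := by rw [h1]
      _ ≤ (B.ncard : ℝ) := by exact_mod_cast Set.ncard_le_ncard h2 hBfin
      _ ≤ 120000 * Y := ncard_gl2zOrbits_neg_le Y
  have hcard : (T.card : ℝ) ≤ Y := by
    have : T.card ≤ Y :=
      calc T.card ≤ (Finset.Ioo (-(Y : ℤ)) 0).card := Finset.card_le_card (Finset.filter_subset _ _)
        _ ≤ Y := by rw [Int.card_Ioo]; omega
    exact_mod_cast this
  calc ∑ D ∈ T, (quadFieldThreeTorsion D : ℝ) = ∑ D ∈ T, (2 * (cubicFieldCountOfDisc D : ℝ) + 1) :=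
        Finset.sum_congr rfl fun D hD => by rw [hdict D (hT D hD).2]; push_cast; ring
    _ = 2 * ∑ D ∈ T, (cubicFieldCountOfDisc D : ℝ) + T.card := by
        rw [Finset.sum_add_distrib, ← Finset.mul_sum, Finset.sum_const, nsmul_eq_mul, mul_one]
    _ ≤ 2 * (120000 * Y) + Y := by linarith
    _ = 240001 * Y := by ring

/-- **Hypothesis (A) of `btt_uniformity_sqDvd_of_mean_of_perDisc` from the dictionary alone**
(both Davenport bounds being proved): `Σ_{D ∈ negFundDiscrs Y} #Cl₃(D) ≤ C·Y` and
`Σ_{D ∈ posFundDiscrs Y} #Cl₃(D) ≤ C·Y` with `C = 240001`.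
[cite: BelabasBhargavaPomerance2010, Lemma 3.3 (proof, first display)] -/
theorem mean_threeTorsion_of_dictionary
    (hdict : ∀ D : ℤ, ((D % 4 = 1 ∧ Squarefree D ∧ D ≠ 1) ∨
      (4 ∣ D ∧ (D / 4 % 4 = 2 ∨ D / 4 % 4 = 3) ∧ Squarefree (D / 4))) →
      quadFieldThreeTorsion D = 2 * cubicFieldCountOfDisc D + 1) :
    ∃ C : ℝ, ∀ Y : ℕ, (∑ D ∈ negFundDiscrs Y, (quadFieldThreeTorsion D : ℝ)) ≤ C * Y ∧
      (∑ D ∈ posFundDiscrs Y, (quadFieldThreeTorsion D : ℝ)) ≤ C * Y := by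
  refine ⟨240001, fun Y => ⟨mean_threeTorsion_neg_of_dictionary hdict Y, ?_⟩⟩
  have := mean_threeTorsion_pos_of_dictionary hdict Y
  have hY : (0 : ℝ) ≤ Y := by positivity
  nlinarith

/-- The same, with the dictionary supplied by the tree's named fact
`threeTorsion_eq_two_mul_cubicFieldCountOfDisc_add_one`. [cite: BelabasBhargavaPomerance2010, Lemma 3.3] -/
theorem mean_threeTorsion_of_dictionary_fact (hdict : threeTorsion_eq_two_mul_cubicFieldCountOfDisc_add_one) :
    ∃ C : ℝ, ∀ Y : ℕ, (∑ D ∈ negFundDiscrs Y, (quadFieldThreeTorsion D : ℝ)) ≤ C * Y ∧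
      (∑ D ∈ posFundDiscrs Y, (quadFieldThreeTorsion D : ℝ)) ≤ C * Y :=
  mean_threeTorsion_of_dictionary hdict

end Literature.NumberTheory.CubicFields

end
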